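import Summits.ResolutionOfSingularities.ResolutionOfSingularities.Theorems.FrobeniusLadderFInjectiveMacaulayficationQuarticChart
import Summits.ResolutionOfSingularities.ResolutionOfSingularities.Theorems.FrobeniusLadderFInjectiveMacaulayficationX2CubicFormSingularCentre
import Summits.ResolutionOfSingularities.ResolutionOfSingularities.Theorems.FrobeniusLadderFInjectiveMacaulayficationX2Cubic4FloorTwoGlue
import HarnessLib

/-!
# (T-I3, habitat #3a) THE QUARTIC T-SIDE CLASS ROUTE: double points `x² + F₄` whose tangent-cone quartic has SMOOTH dehomogenisations — the NON-NORMAL point floor, singular along the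
# whole reduced exceptional divisor, is regularised by ONE blowing up along its reduced singular locus: `TStepInstanceAt p v 𝔪̃`, bed-free, every `p ≠ 2`
# (crux `FInjectiveMacaulayfication` stmt-ResolutionOfSingularities-15315, chain w45a; mirror of ✓p680581 `X2CubicFormTStep` over the quartic chart package ✓/⧗ `QuarticChart`
# (pinch model ✓p685811 `PinchStrictTransform`, ✓p686051 `PinchSingularLocus`); `Lines/T-I3-firststep.md` §3 #3a; seat res-L1-w45a-lead-1 g11)

[OURS · L1 W4.5a] Support file (`--supports stmt-ResolutionOfSingularities-15315 --as helper`); def-free; UNCONDITIONAL; no named fact; NOT a statement of any manuscript. A CLASS-LEVEL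
instance theorem for the inner block of the T″ stub: evidence for nothing beyond the class it names (a NEW HABITAT: codimension-one centre, non-normal FULL floor); the T″ stub
and the F-half stay OPEN; nothing of the crux is proved. AI-written (AI review is weaker than expert review).

THE CLASS: `Y = Spec k[X₀..X₄]/(f)`, `f` PRIME, `constantCoeff f = 0`, `f ∉ (Xᵢ)`, `Y` regular off the origin `v`; strict transforms `θᵢ f = Xᵢ²·G i` with, for `a ≤ 3`,
`G a = X₄² + X_a² · rename (e a) (w a)`, `w a ∈ k[Y₀,Y₁,Y₂]` with SMOOTH zero locus (`∀` prime `Q ∋ w a` `∃ D`, `D (w a) ∉ Q`), and `G 4 = 1 + X₄²·q`, `∂₄q = 0`; `2 ≠ 0` in `k`.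
* §1 small certificates: `G_not_mem_span_X`, `G4_not_mem_span_X`, `isRegularRing_quotient_one_add_X_sq_mul`.
* §2 ★★ `isRegular_of_isBlowup_vanishingIdeal` — EVERY blowing up of `Y₁ = Bl_𝔪 Y` along `𝓚_Σ = vanishingIdeal (Reg Y₁)ᶜ` is a REGULAR scheme (four singular charts by
  `QuarticChart.chart_package4` / `isRegular_affineBlowup_chart4`, the `x`-chart regular with unit centre; glue `E4FloorTwoGlue.isRegular_of_isBlowup_of_charts`).
* §3 ★★★ `tStepInstanceAt_of_doublePoint_quarticCharts` — `TStepGerm.TStepInstanceAt p v (𝔪̃·𝒪_{Y,v})` for EVERY member of the class, every `p`.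
[folklore assembly; cite: GortzWedhorn2020, Prop. 13.91 (2), Prop. 13.92, (13.19); Liu2002, Thm. 8.1.19 (a); StacksProject, Tag 0804, Tag 07PF; Temkin2008, §2.1]
-/

-- single-problem summit: the doubled namespace component is forced
set_option linter.dupNamespace false

noncomputable section

namespace Summit.ResolutionOfSingularities.ResolutionOfSingularities.Theorems.FInjectiveMacaulayfication.QuarticTStep

open MvPolynomial Literature.AlgebraicGeometry.Resolution AlgebraicGeometry CategoryTheory CategoryTheory.Limits TopologicalSpace
open Summit.ResolutionOfSingularities.ResolutionOfSingularities.Theorems.FInjectiveMacaulayfication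

/-! ## §1 Small certificates -/

/-- `X₄² + X_a²·W ∉ (X_a)` for `a ≠ 4` (evaluate at `e₄`). [elementary] -/
theorem G_not_mem_span_X (k : Type) [Field k] (a : Fin 5) (ha : a ≠ 4) (W G : MvPolynomial (Fin 5) k) (hG : G = X 4 ^ 2 + X a ^ 2 * W) :
    G ∉ Ideal.span {(X a : MvPolynomial (Fin 5) k)} := by
  intro h
  obtain ⟨c, hc⟩ := Ideal.mem_span_singleton.mp h
  have := congrArg (MvPolynomial.eval (Pi.single 4 1 : Fin 5 → k)) hc
  rw [hG] at this
  simp [ha] at this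

/-- `1 + X₄²·q ∉ (X₄)` (evaluate at `0`). [elementary] -/
theorem G4_not_mem_span_X (k : Type) [Field k] (q G : MvPolynomial (Fin 5) k) (hG : G = 1 + X 4 ^ 2 * q) :
    G ∉ Ideal.span {(X 4 : MvPolynomial (Fin 5) k)} := by
  intro h
  obtain ⟨c, hc⟩ := Ideal.mem_span_singleton.mp h
  have := congrArg (MvPolynomial.eval (0 : Fin 5 → k)) hc
  rw [hG] at this
  simp at this

/-- **`k[X]/(1 + X₄²·q)` is a regular ring** for `q` free of `X₄` and `2 ≠ 0`: `∂₄(1 + X₄²q) = 2X₄q` is a unit modulo `1 + X₄²q` (inverse `−X₄/2`; Stacks 07PF).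
[cite: StacksProject, Tag 07PF] -/
theorem isRegularRing_quotient_one_add_X_sq_mul (k : Type) [Field k] (h2 : (2 : k) ≠ 0) (q G : MvPolynomial (Fin 5) k) (hG : G = 1 + X 4 ^ 2 * q) (hq : pderiv 4 q = 0) :
    IsRegularRing (MvPolynomial (Fin 5) k ⧸ Ideal.span {G}) := by
  have hd : (pderiv 4 : Derivation k (MvPolynomial (Fin 5) k) (MvPolynomial (Fin 5) k)) G = 2 * X 4 * q := by
    rw [hG, map_add, Derivation.map_one_eq_zero, Derivation.leibniz, hq, Derivation.leibniz_pow, pderiv_X_self, smul_zero, zero_add, zero_add]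
    simp only [smul_eq_mul, mul_one, nsmul_eq_mul]
    push_cast; ring
  refine isRegularRing_quotient_of_derivation G (pderiv 4 : Derivation k (MvPolynomial (Fin 5) k) (MvPolynomial (Fin 5) k)) ?_
  rw [hd]
  refine IsUnit.of_mul_eq_one (Ideal.Quotient.mk (Ideal.span {G}) (-(C (2 : k)⁻¹ * X 4))) ?_
  rw [← map_mul, ← (Ideal.Quotient.mk (Ideal.span {G})).map_one, Ideal.Quotient.eq, Ideal.mem_span_singleton]
  have h2C : (C (2 : k)⁻¹ : MvPolynomial (Fin 5) k) * 2 = 1 := by rw [← map_ofNat C 2, ← map_mul, inv_mul_cancel₀ h2, map_one]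
  exact ⟨-1, by rw [hG]; linear_combination (-(X 4 ^ 2 * q)) * h2C⟩

/-! ## §2 Every blowing up of the point floor along the reduced singular locus is regular -/

set_option maxHeartbeats 400000 in
/-- ★★ **CLASS-LEVEL REGULARITY (quartic habitat).** Under the class hypotheses (see the file header): EVERY blowing up of `Y₁ = Bl_𝔪 Y` along `𝓚_Σ = vanishingIdeal Z`, `↑Z = (Reg Y₁)ᶜ`, is a REGULAR
scheme. [folklore assembly; cite: GortzWedhorn2020, Prop. 13.91 (2); Liu2002, Thm. 8.1.19 (a)] -/
theorem isRegular_of_isBlowup_vanishingIdeal (k : Type) [Field k] (h2 : (2 : k) ≠ 0) (f : MvPolynomial (Fin 5) k) (hprime : Prime f)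
    (hfX : ∀ i : Fin 5, f ∉ Ideal.span {(X i : MvPolynomial (Fin 5) k)})
    (G : Fin 5 → MvPolynomial (Fin 5) k)
    (hθ : ∀ i : Fin 5, MvPolynomial.aeval (fun j : Fin 5 => if j = i then (X i : MvPolynomial (Fin 5) k) else X j * X i) f = X i ^ 2 * G i)
    (w : Fin 4 → MvPolynomial (Fin 3) k)
    (hGw : ∀ a : Fin 4, G (Fin.castSucc a) = X 4 ^ 2 + X (Fin.castSucc a) ^ 2 * rename ((![![1, 2, 3], ![0, 2, 3], ![0, 1, 3], ![0, 1, 2]] : Fin 4 → Fin 3 → Fin 5) a) (w a))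
    (hws : ∀ (a : Fin 4) (Q : Ideal (MvPolynomial (Fin 3) k)), Q.IsPrime → w a ∈ Q → ∃ D : Derivation k (MvPolynomial (Fin 3) k) (MvPolynomial (Fin 3) k), D (w a) ∉ Q)
    (q : MvPolynomial (Fin 5) k) (hG4 : G 4 = 1 + X 4 ^ 2 * q) (hq : pderiv 4 q = 0)
    (𝔪 : Ideal (MvPolynomial (Fin 5) k ⧸ Ideal.span {f})) (h𝔪 : 𝔪 = Ideal.span (Set.range fun j : Fin 5 => Ideal.Quotient.mk (Ideal.span {f}) (X j)))
    (Z : Closeds ↥(affineBlowup 𝔪)) (hZ : (Z : Set ↥(affineBlowup 𝔪)) = (Scheme.regularLocus (affineBlowup 𝔪))ᶜ)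
    {X₂ : Scheme.{0}} (π₂ : X₂ ⟶ affineBlowup 𝔪) (hπ₂ : IsBlowup π₂ (Scheme.IdealSheafData.vanishingIdeal Z)) :
    Scheme.IsRegular X₂ := by
  subst h𝔪
  haveI hfprime : (Ideal.span {f}).IsPrime := (Ideal.span_singleton_prime hprime.ne_zero).mpr hprime
  -- the four singular charts, by `QuarticChart` at explicit splittings `π_a`
  have hG0 : G 0 = X 4 ^ 2 + X 0 ^ 2 * rename ![1, 2, 3] (w 0) := hGw 0
  have hG1 : G 1 = X 4 ^ 2 + X 1 ^ 2 * rename ![0, 2, 3] (w 1) := hGw 1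
  have hG2 : G 2 = X 4 ^ 2 + X 2 ^ 2 * rename ![0, 1, 3] (w 2) := hGw 2
  have hG3 : G 3 = X 4 ^ 2 + X 3 ^ 2 * rename ![0, 1, 2] (w 3) := hGw 3
  -- centres
  obtain ⟨CC, hCC⟩ : ∃ CC : Fin 5 → Fin 2 → MvPolynomial (Fin 5) k,
      CC = ![![X 4, X 0], ![X 4, X 1], ![X 4, X 2], ![X 4, X 3], ![1, 1]] := ⟨_, rfl⟩
  -- the regular chart: centre = unit ideal
  have unit_chart : ∀ (g : MvPolynomial (Fin 5) k) (c : Fin 2 → MvPolynomial (Fin 5) k), c 0 = 1 → IsRegularRing (MvPolynomial (Fin 5) k ⧸ Ideal.span {g}) →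
      ∀ (j : Spec (.of (MvPolynomial (Fin 5) k ⧸ Ideal.span {g})) ⟶ affineBlowup (Ideal.span (Set.range fun j : Fin 5 =>
        Ideal.Quotient.mk (Ideal.span {f}) (X j)))) [IsOpenImmersion j],
      (Scheme.IdealSheafData.vanishingIdeal Z).comap j =
          affineBlowup.idealSheaf ((Ideal.span (Set.range c)).map (Ideal.Quotient.mk (Ideal.span {g}))) ∧
        Scheme.IsRegular (affineBlowup ((Ideal.span (Set.range c)).map (Ideal.Quotient.mk (Ideal.span {g})))) := by
    intro g c hc hreg j _
    have htop : (Ideal.span (Set.range c)).map (Ideal.Quotient.mk (Ideal.span {g})) = ⊤ := by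
      rw [Ideal.eq_top_iff_one, ← map_one (Ideal.Quotient.mk (Ideal.span {g}))]
      exact Ideal.mem_map_of_mem _ (Ideal.subset_span ⟨0, hc⟩)
    rw [htop]
    refine ⟨E4FloorTwoGlue.comap_vanishingIdeal_eq_idealSheaf Z hZ j ⊤ (Ideal.radical_top _) fun P hP => ?_, E4FloorTwoGlue.isRegular_affineBlowup_top⟩
    exact ⟨fun h => (h (IsRegularRing.isRegularLocalRing_localization P)).elim, fun h => (hP.ne_top (top_le_iff.mp h)).elim⟩
  -- per-chart facts: the reduced singular locus restricts to `J̃_i`, and `Bl_{J_i}` is regular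
  have hchart : ∀ (i : Fin 5) (ι : Spec (.of (MvPolynomial (Fin 5) k ⧸ Ideal.span {G i})) ⟶ affineBlowup (Ideal.span (Set.range fun j : Fin 5 =>
        Ideal.Quotient.mk (Ideal.span {f}) (X j)))) [IsOpenImmersion ι],
      (Scheme.IdealSheafData.vanishingIdeal Z).comap ι =
          affineBlowup.idealSheaf ((Ideal.span (Set.range (CC i))).map (Ideal.Quotient.mk (Ideal.span {G i}))) ∧
        Scheme.IsRegular (affineBlowup ((Ideal.span (Set.range (CC i))).map (Ideal.Quotient.mk (Ideal.span {G i})))) := by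
    intro i ι hι
    fin_cases i
    · have hC : CC 0 = ![X 4, X 0] := by rw [hCC]; rfl
      obtain ⟨-, hsing, hpr⟩ := QuarticChart.chart_package4 k h2 ((_root_.finRotate 5).trans (finSumFinEquiv (m := 2) (n := 3)).symm) 0
        (by decide) (by decide) ![1, 2, 3] (by decide) (w 0) (hws 0) (G 0) hG0 (CC 0) hC _ rfl
      exact ⟨@E4FloorTwoGlue.comap_vanishingIdeal_eq_idealSheaf _ Z hZ _ _ ι hι _ hpr.radical fun P hP => @hsing P hP,
        QuarticChart.isRegular_affineBlowup_chart4 k h2 ((_root_.finRotate 5).trans (finSumFinEquiv (m := 2) (n := 3)).symm) 0 (by decide) (by decide) ![1, 2, 3] (by decide) (w 0) (hws 0) (G 0) hG0 (CC 0) hC _ rfl⟩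
    · have hC : CC 1 = ![X 4, X 1] := by rw [hCC]; rfl
      obtain ⟨-, hsing, hpr⟩ := QuarticChart.chart_package4 k h2 ((Equiv.swap (0 : Fin 5) 1).trans ((_root_.finRotate 5).trans (finSumFinEquiv (m := 2) (n := 3)).symm)) 1
        (by decide) (by decide) ![0, 2, 3] (by decide) (w 1) (hws 1) (G 1) hG1 (CC 1) hC _ rfl
      exact ⟨@E4FloorTwoGlue.comap_vanishingIdeal_eq_idealSheaf _ Z hZ _ _ ι hι _ hpr.radical fun P hP => @hsing P hP,
        QuarticChart.isRegular_affineBlowup_chart4 k h2 ((Equiv.swap (0 : Fin 5) 1).trans ((_root_.finRotate 5).trans (finSumFinEquiv (m := 2) (n := 3)).symm)) 1 (by decide) (by decide) ![0, 2, 3] (by decide) (w 1) (hws 1) (G 1) hG1 (CC 1) hC _ rfl⟩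
    · have hC : CC 2 = ![X 4, X 2] := by rw [hCC]; rfl
      obtain ⟨-, hsing, hpr⟩ := QuarticChart.chart_package4 k h2
        (((Equiv.swap (0 : Fin 5) 1).trans (Equiv.swap (0 : Fin 5) 2)).trans ((_root_.finRotate 5).trans (finSumFinEquiv (m := 2) (n := 3)).symm)) 2
        (by decide) (by decide) ![0, 1, 3] (by decide) (w 2) (hws 2) (G 2) hG2 (CC 2) hC _ rfl
      exact ⟨@E4FloorTwoGlue.comap_vanishingIdeal_eq_idealSheaf _ Z hZ _ _ ι hι _ hpr.radical fun P hP => @hsing P hP,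
        QuarticChart.isRegular_affineBlowup_chart4 k h2 (((Equiv.swap (0 : Fin 5) 1).trans (Equiv.swap (0 : Fin 5) 2)).trans ((_root_.finRotate 5).trans (finSumFinEquiv (m := 2) (n := 3)).symm)) 2 (by decide) (by decide) ![0, 1, 3] (by decide) (w 2) (hws 2) (G 2) hG2 (CC 2) hC _ rfl⟩
    · have hC : CC 3 = ![X 4, X 3] := by rw [hCC]; rfl
      obtain ⟨-, hsing, hpr⟩ := QuarticChart.chart_package4 k h2
        ((((Equiv.swap (0 : Fin 5) 1).trans (Equiv.swap (0 : Fin 5) 2)).trans (Equiv.swap (0 : Fin 5) 3)).trans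
          ((_root_.finRotate 5).trans (finSumFinEquiv (m := 2) (n := 3)).symm)) 3
        (by decide) (by decide) ![0, 1, 2] (by decide) (w 3) (hws 3) (G 3) hG3 (CC 3) hC _ rfl
      exact ⟨@E4FloorTwoGlue.comap_vanishingIdeal_eq_idealSheaf _ Z hZ _ _ ι hι _ hpr.radical fun P hP => @hsing P hP,
        QuarticChart.isRegular_affineBlowup_chart4 k h2 ((((Equiv.swap (0 : Fin 5) 1).trans (Equiv.swap (0 : Fin 5) 2)).trans (Equiv.swap (0 : Fin 5) 3)).trans
          ((_root_.finRotate 5).trans (finSumFinEquiv (m := 2) (n := 3)).symm)) 3 (by decide) (by decide) ![0, 1, 2] (by decide) (w 3) (hws 3) (G 3) hG3 (CC 3) hC _ rfl⟩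
    · -- the regular chart `D₊(x)`: centre = unit ideal
      exact @unit_chart (G 4) (CC 4) (by rw [hCC]; rfl) (isRegularRing_quotient_one_add_X_sq_mul k h2 q (G 4) hG4 hq) ι hι
  -- `G i ∉ (X i)`, primality of the charts, the chart isomorphisms
  have hGX : ∀ i : Fin 5, G i ∉ Ideal.span {(X i : MvPolynomial (Fin 5) k)} := by
    intro i
    fin_cases i
    · exact G_not_mem_span_X k 0 (by decide) _ (G 0) hG0
    · exact G_not_mem_span_X k 1 (by decide) _ (G 1) hG1
    · exact G_not_mem_span_X k 2 (by decide) _ (G 2) hG2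
    · exact G_not_mem_span_X k 3 (by decide) _ (G 3) hG3
    · exact G4_not_mem_span_X k q (G 4) hG4
  have hGprime : ∀ i : Fin 5, (Ideal.span {G i}).IsPrime := fun i =>
    (PrimeTransfer.stub_primeTransfer k 5 i f (G i) 2 (hθ i) (hfX i) (hGX i)).mp hfprime
  have hXG : ∀ i : Fin 5, (X i : MvPolynomial (Fin 5) k) ∉ Ideal.span {G i} := fun i =>
    PrimeTransfer.X_not_mem_span_of_isPrime (hGprime i) (hGX i)
  have he : ∀ i : Fin 5, ∃ e : (MvPolynomial (Fin 5) k ⧸ Ideal.span {G i}) ≃+*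
      HomogeneousLocalization.Away (reesGrading (Ideal.span (Set.range fun j : Fin 5 => Ideal.Quotient.mk (Ideal.span {f}) (X j))))
        (reesT (Ideal.Quotient.mk (Ideal.span {f}) (X i)) (Ideal.subset_span (Set.mem_range_self i))),
      e (Ideal.Quotient.mk (Ideal.span {G i}) (X i)) =
        reesChartBase (Ideal.Quotient.mk (Ideal.span {f}) (X i)) (Ideal.subset_span (Set.mem_range_self i)) (Ideal.Quotient.mk (Ideal.span {f}) (X i)) :=
    fun i => StrictTransformChartN.stub_strictTransformChartN k 5 f (G i) i 2 hfprime hprime.ne_zero (hGprime i) (hXG i) (hθ i) _ rfl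
  choose e _ using he
  refine E4FloorTwoGlue.isRegular_of_isBlowup_of_charts (Scheme.IdealSheafData.vanishingIdeal Z) hπ₂ (fun i : Fin 5 => MvPolynomial (Fin 5) k ⧸ Ideal.span {G i})
    (fun i => Spec.map (e i).symm.toCommRingCatIso.hom ≫
      affineBlowup.chartι (Ideal.Quotient.mk (Ideal.span {f}) (X i)) (Ideal.subset_span (Set.mem_range_self i)))
    (fun x₁ => ?_) (fun i => (Ideal.span (Set.range (CC i))).map (Ideal.Quotient.mk (Ideal.span {G i})))
    (fun i => (hchart i _).1) (fun i => (hchart i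
      (Spec.map (e i).symm.toCommRingCatIso.hom ≫ affineBlowup.chartι (Ideal.Quotient.mk (Ideal.span {f}) (X i)) (Ideal.subset_span (Set.mem_range_self i)))).2)
  -- (COV) the charts `D₊(x̄ᵢ t)` cover `Y₁`
  have htop := affineBlowup.iSup_basicOpen_reesT_generators_eq_top (fun j : Fin 5 => Ideal.Quotient.mk (Ideal.span {f}) (X j))
  have hx : x₁ ∈ (⨆ i : Fin 5, Proj.basicOpen (reesGrading (Ideal.span (Set.range fun j : Fin 5 => Ideal.Quotient.mk (Ideal.span {f}) (X j))))
      (reesT (Ideal.Quotient.mk (Ideal.span {f}) (X i)) (Ideal.mem_span_range_self (f := fun j : Fin 5 => Ideal.Quotient.mk (Ideal.span {f}) (X j)) (x := i)))) := by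
    rw [htop]; trivial
  obtain ⟨i, hi⟩ := Opens.mem_iSup.mp hx
  rw [← affineBlowup.image_top_chartι] at hi
  obtain ⟨y, -, hy⟩ := hi
  obtain ⟨y', hy'⟩ := (Spec.map (e i).symm.toCommRingCatIso.hom).surjective y
  refine ⟨i, y', ?_⟩
  rw [Scheme.Hom.comp_apply, hy']
  exact hy

/-! ## §3 The class theorem -/

/-- ★★★ **THE QUARTIC T-SIDE CLASS ROW: `TStepInstanceAt p v (𝔪̃·𝒪_{Y,v})` for EVERY double point `x² + F₄` whose tangent-cone quartic has SMOOTH dehomogenisations** (`2 ≠ 0`).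
Hypotheses (certificate-style): `f` PRIME, no constant term, `f ∉ (Xᵢ)`, `Y` regular off the origin; strict transforms `θᵢ f = Xᵢ²·G i` with `G a = X₄² + X_a²·rename (e a) (w a)`
(`a ≤ 3`, `V(w a)` smooth pointwise) and `G 4 = 1 + X₄²·q`, `∂₄ q = 0`. Conclusion: for every `p`, for every blowing up `g : S′ → Spec 𝒪_{Y,v}` along `𝔪̃·𝒪_{Y,v}` there is a
fibre-supported `𝓚 ≠ ⊥` on `S′` — the REDUCED SINGULAR LOCUS = the reduced exceptional divisor `E_red ≅ ℙ³`, a centre of CODIMENSION ONE in the non-normal floor — ALL of whose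
blowings up are REGULAR. A new habitat for the T″ stub (compare the cubic class ✓p680581: centre a surface, transversal A₁). [OURS · class-level certificate theorem; folklore assembly;
cite: GortzWedhorn2020, Prop. 13.91 (2), Prop. 13.92; Liu2002, Thm. 8.1.19 (a); StacksProject, Tag 07PF] -/
theorem tStepInstanceAt_of_doublePoint_quarticCharts (k : Type) [Field k] (h2 : (2 : k) ≠ 0) (p : ℕ) (f : MvPolynomial (Fin 5) k) (hprime : Prime f) (hf0 : constantCoeff f = 0)
    (hfX : ∀ i : Fin 5, f ∉ Ideal.span {(X i : MvPolynomial (Fin 5) k)})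
    (hoff : ∀ (P : Ideal (MvPolynomial (Fin 5) k ⧸ Ideal.span {f})) [P.IsPrime],
      ¬ Ideal.span (Set.range fun j : Fin 5 => Ideal.Quotient.mk (Ideal.span {f}) (X j)) ≤ P → IsRegularLocalRing (Localization.AtPrime P))
    (G : Fin 5 → MvPolynomial (Fin 5) k)
    (hθ : ∀ i : Fin 5, MvPolynomial.aeval (fun j : Fin 5 => if j = i then (X i : MvPolynomial (Fin 5) k) else X j * X i) f = X i ^ 2 * G i)
    (w : Fin 4 → MvPolynomial (Fin 3) k)
    (hGw : ∀ a : Fin 4, G (Fin.castSucc a) = X 4 ^ 2 + X (Fin.castSucc a) ^ 2 * rename ((![![1, 2, 3], ![0, 2, 3], ![0, 1, 3], ![0, 1, 2]] : Fin 4 → Fin 3 → Fin 5) a) (w a))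
    (hws : ∀ (a : Fin 4) (Q : Ideal (MvPolynomial (Fin 3) k)), Q.IsPrime → w a ∈ Q → ∃ D : Derivation k (MvPolynomial (Fin 3) k) (MvPolynomial (Fin 3) k), D (w a) ∉ Q)
    (q : MvPolynomial (Fin 5) k) (hG4 : G 4 = 1 + X 4 ^ 2 * q) (hq : pderiv 4 q = 0)
    (v : Spec (.of (MvPolynomial (Fin 5) k ⧸ Ideal.span {f})))
    (hv : v.asIdeal = Ideal.span (Set.range fun j : Fin 5 => Ideal.Quotient.mk (Ideal.span {f}) (X j))) :
    TStepGerm.TStepInstanceAt p v ((affineBlowup.idealSheaf (Ideal.span (Set.range fun j : Fin 5 => Ideal.Quotient.mk (Ideal.span {f}) (X j)))).comap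
      ((Spec (.of (MvPolynomial (Fin 5) k ⧸ Ideal.span {f}))).fromSpecStalk v)) := by
  let 𝔪 : Ideal (MvPolynomial (Fin 5) k ⧸ Ideal.span {f}) := Ideal.span (Set.range fun j : Fin 5 => Ideal.Quotient.mk (Ideal.span {f}) (X j))
  let Z : Closeds ↥(affineBlowup 𝔪) := ⟨(Scheme.regularLocus (affineBlowup 𝔪))ᶜ, E4GermSingularCentre.isClosed_compl_regularLocus k f 𝔪⟩
  have hZ : (Z : Set ↥(affineBlowup 𝔪)) = (Scheme.regularLocus (affineBlowup 𝔪))ᶜ := rfl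
  obtain ⟨X₂, π₂, hπ₂⟩ := exists_isBlowup (affineBlowup 𝔪) (Scheme.IdealSheafData.vanishingIdeal Z)
  have hreg := isRegular_of_isBlowup_vanishingIdeal k h2 f hprime hfX G hθ w hGw hws q hG4 hq 𝔪 rfl Z hZ π₂ hπ₂
  exact TStepGerm.tStepInstanceAt_of_isBlowup p v (affineBlowup.isBlowup 𝔪) (Scheme.IdealSheafData.vanishingIdeal Z)
    (X2CubicFormSingularCentre.comap_pullback_fst_vanishingIdeal_ne_bot k f hprime hf0 (hfX 0) hoff v hv 𝔪 rfl Z hZ)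
    (X2CubicFormSingularCentre.support_vanishingIdeal_over_vertex k f hf0 hoff v hv 𝔪 rfl Z hZ) hπ₂ fun x₂ _ => hreg x₂

end Summit.ResolutionOfSingularities.ResolutionOfSingularities.Theorems.FInjectiveMacaulayfication.QuarticTStep

end
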